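/-
Copyright (c) 2026. All rights reserved.
Released under Apache 2.0 license as described in the file LICENSE.
Authors: solo-Langlands-informed (ideation tier, family 6).
-/
import Literature.NumberTheory.PAdicHodge.LogCyclotomicCharacterNotCoboundary
import HarnessLib

/-!
# `ℂ_F`-admissible characters have logarithms that are coboundaries, and open subgroups of `Γ_F`
# contain fixators of finite extensions (Tate 1967 §3.3; Serre III-A.2, A.5–A.6)

Topic `Literature/NumberTheory/PAdicHodge`; namespace `Literature.NumberTheory.PAdicHodge`. Sequel of
`LogCyclotomicCharacterNotCoboundary` (the Galois action `gal σ` on the `ℚ_p`-normalised copy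
`PadicCompletedAlgClosure F p hp` of `ℂ_F`; `[log χ] ≠ 0`). Three elementary tools of Tate's method
(Serre, *Abelian ℓ-adic representations*, III-A: the invariant of a character `φ` of `H = Gal(F̄/M)` is the
class `[log φ] ∈ H¹(H, ℂ_F) = Fun(H, ℂ_F)/{h ↦ h c − c}`, and «`φ` is `ℂ`-admissible ⇔ [log φ] = 0», A.2
Proposition 2 with A.1), in the concrete inside-`ℂ_F` form in which they are used:
* §1 `PadicCompletedAlgClosure.exists_coe_ne_zero_norm_div_sub_one_lt` — **density of `F̄` in `ℂ_F`,
  multiplicative form**: every `x ≠ 0` in `ℂ_F` is `a · v` with `a ∈ F̄^×` and `‖v − 1‖ < ε`.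
* §2 ★ `PadicCompletedAlgClosure.exists_plog_eq_gal_sub_of_semiInvariant` — **the easy half of Serre's
  A.2 Proposition 2, «admissible ⇒ the class of `log φ` vanishes»**: if `x ≠ 0` and `σ x = φ(σ) x` for all
  `σ` fixing a finite `M/F`, then after enlarging `M` to a finite `M' ⊇ M` one has `‖1 − φ(σ)‖ < ε` and
  `plog φ(σ) = σ c − c` (`c = plog(x/a)`) for all `σ` fixing `M'`. (Proof: write `x = a v` by §1 and adjoin
  `a` to `M`; then `σ v / v = φ(σ)`, and `plog` is a homomorphism on `1 + 𝔪` commuting with `σ`.) No Iwasawa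
  logarithm on all of `ℂ_F^×` is needed.
* §3 `exists_intermediateField_finiteDimensional_fixing_subset` — **every neighbourhood of `1` in `Γ_F`
  contains the fixator of a finite extension `M' ⊇ M`** (the Krull topology, Mathlib
  `krullTopology_mem_nhds_one_iff`, transported to the tree's `NormedAlgClosure F`): the device by which
  «for `σ` in a small open subgroup» is realised as «for `σ` fixing `M'`» throughout the inside-`ℂ_F` proof
  of Tate's theorem (continuity of the finitely many characters in play).
Use: inputs (R5) and (r3) of the relative proof of «de Rham rank-one characters of `Γ_F` are locally
algebraic» for `[F : ℚ_p] > 1` (`n = 1` conjunct of `Summit.Langlands` at ℓ-adic places of degree `> 1`).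

## References
* [Tate1967] J. T. Tate, *p-divisible groups* (Driebergen 1966), Springer 1967, §3.3.
* [SerreAbelianLadic1968] J.-P. Serre, *Abelian ℓ-adic representations and elliptic curves*, Benjamin 1968, Ch. III, App. A.1–A.2 (Proposition 2), A.5–A.6.
* [FontaineOuyang2022] J.-M. Fontaine, Y. Ouyang, *Theory of p-adic Galois representations*, §3.1.
-/

noncomputable section

open NormedSpace IsUltrametricDist ValuativeRel
open scoped Topology IntermediateField

namespace Literature.NumberTheory.PAdicHodge

open Literature.NumberTheory.GaloisRepresentations
open Literature.NumberTheory.GaloisRepresentations.IsNonarchimedeanLocalField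
open Literature.NumberTheory.LocalFields
open Literature.NumberTheory.Transcendental
open Field

variable {F : Type} [Field F] [ValuativeRel F] [TopologicalSpace F] [IsNonarchimedeanLocalField F]
  [CharZero F] {p : ℕ} [hprime : Fact p.Prime] (hp : valuation F p < 1)

namespace PadicCompletedAlgClosure

/-! ## §1 Density of `F̄` in `ℂ_F`, multiplicative form -/

/-- The embedding `F̄ → ℂ_F`, read on the synonym. [cite: FontaineOuyang2022, §3.1] -/
def ofAlgClosure (a : NormedAlgClosure F) : PadicCompletedAlgClosure F p hp :=
  (toC hp).symm (a : CompletedAlgClosure F)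

omit [CharZero F] hprime in
/-- Unfolding: `toC (ofAlgClosure a) = ↑a`. [cite: FontaineOuyang2022, §3.1] -/
@[simp] theorem toC_ofAlgClosure (a : NormedAlgClosure F) :
    toC hp (ofAlgClosure hp a) = (a : CompletedAlgClosure F) := rfl

omit [CharZero F] hprime in
/-- `ofAlgClosure` is the ring homomorphism `F̄ → ℂ_F`. [cite: FontaineOuyang2022, §3.1] -/
theorem ofAlgClosure_eq_coeRingHom (a : NormedAlgClosure F) :
    ofAlgClosure hp a = (toC hp).symm (UniformSpace.Completion.coeRingHom a) := rfl

omit [CharZero F] hprime in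
/-- `ofAlgClosure 0 = 0`. [cite: FontaineOuyang2022, §3.1] -/
@[simp] theorem ofAlgClosure_zero : ofAlgClosure hp (0 : NormedAlgClosure F) = 0 := by
  rw [ofAlgClosure_eq_coeRingHom, map_zero, map_zero]

omit [CharZero F] hprime in
/-- **`Γ_F`-equivariance of `F̄ → ℂ_F`**: `gal σ (ofAlgClosure a) = ofAlgClosure (σ • a)`.
[cite: FontaineOuyang2022, §3.1] -/
theorem gal_ofAlgClosure (σ : absoluteGaloisGroup F) (a : NormedAlgClosure F) :
    gal hp σ (ofAlgClosure hp a) = ofAlgClosure hp (σ • a) := by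
  apply (toC hp).injective
  rw [toC_gal, toC_ofAlgClosure, toC_ofAlgClosure, CompletedAlgClosure.smul_coe]

/-- **`F̄` is dense in `ℂ_F`** (read on the synonym, which has the topology of `ℂ_F`). [cite: FontaineOuyang2022, §3.1] -/
theorem denseRange_ofAlgClosure : DenseRange (ofAlgClosure hp : NormedAlgClosure F → PadicCompletedAlgClosure F p hp) :=
  UniformSpace.Completion.denseRange_coe

/-- **Density, multiplicative form**: for `x ≠ 0` in `ℂ_F` and `ε > 0` there is `a ∈ F̄`, `a ≠ 0`, with
`‖x / a − 1‖ < ε` (choose `a` with `‖x − a‖ < min(‖x‖, ε‖x‖)`; then `‖a‖ = ‖x‖` by the ultrametric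
inequality). [cite: SerreAbelianLadic1968, Ch. III §A.1] -/
theorem exists_coe_ne_zero_norm_div_sub_one_lt {x : PadicCompletedAlgClosure F p hp} (hx : x ≠ 0)
    {ε : ℝ} (hε : 0 < ε) :
    ∃ a : NormedAlgClosure F, ofAlgClosure hp a ≠ 0 ∧ ‖x / ofAlgClosure hp a - 1‖ < ε := by
  have hx0 : 0 < ‖x‖ := norm_pos_iff.mpr hx
  obtain ⟨a, ha⟩ := Metric.denseRange_iff.mp (denseRange_ofAlgClosure hp) x (min ‖x‖ (ε * ‖x‖))
    (lt_min hx0 (mul_pos hε hx0))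
  rw [dist_eq_norm] at ha
  have ha1 : ‖x - ofAlgClosure hp a‖ < ‖x‖ := lt_of_lt_of_le ha (min_le_left _ _)
  have ha2 : ‖x - ofAlgClosure hp a‖ < ε * ‖x‖ := lt_of_lt_of_le ha (min_le_right _ _)
  -- `‖a‖ = ‖x‖`
  have hna : ‖ofAlgClosure hp a‖ = ‖x‖ := by
    have h' : ‖x + -ofAlgClosure hp a‖ < max ‖x‖ ‖-ofAlgClosure hp a‖ := by
      rw [← sub_eq_add_neg]; exact lt_of_lt_of_le ha1 (le_max_left _ _)
    have h := norm_eq_of_add_norm_lt_max h'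
    rw [norm_neg] at h
    exact h.symm
  have ha0 : ofAlgClosure hp a ≠ 0 := by
    intro h0; rw [h0, norm_zero] at hna; exact hx0.ne hna
  refine ⟨a, ha0, ?_⟩
  have hdiv : x / ofAlgClosure hp a - 1 = (x - ofAlgClosure hp a) / ofAlgClosure hp a := by
    field_simp
  rw [hdiv, norm_div, hna, div_lt_iff₀ hx0]
  exact ha2

/-! ## §2 Admissible ⇒ `[log φ] = 0` -/

/-- If `‖w − 1‖ < 1` then `‖w‖ = 1` (ultrametric). [cite: SerreAbelianLadic1968, Ch. III §A.1] -/
theorem norm_eq_one_of_norm_sub_one_lt {w : PadicCompletedAlgClosure F p hp} (hw : ‖w - 1‖ < 1) : ‖w‖ = 1 := by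
  have h : w = (w - 1) + 1 := by ring
  have hne : ‖w - 1‖ ≠ ‖(1 : PadicCompletedAlgClosure F p hp)‖ := by rw [norm_one]; exact hw.ne
  rw [h, norm_add_eq_max_of_norm_ne_norm hne, norm_one, max_eq_right hw.le]

/-- ★ **Admissible ⇒ the class of `log φ` vanishes** (the easy half of Serre III-A.2 Proposition 2, inside
`ℂ_F`). Let `M ⊆ F̄` be finite over `F`, `x ∈ ℂ_F` non-zero and `φ : Γ_F → ℂ_F` with `σ x = φ(σ)·x` for every
`σ` fixing `M` pointwise. Then for every `0 < ε ≤ 1` there are a finite `M' ⊇ M` and `c ∈ ℂ_F` such that for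
every `σ` fixing `M'`: `‖1 − φ(σ)‖ < ε` and `plog φ(σ) = σ(c) − c`. (Write `x = a·v`, `a ∈ F̄^×`, `‖v − 1‖ < ε`
by density; on the fixator of `M' = M·F(a)`, `σ v = φ(σ) v`, so `φ(σ) = σ(v)/v` is `ε`-close to `1` and
`plog φ(σ) = σ(plog v) − plog v`.) [cite: SerreAbelianLadic1968, Ch. III §A.2 Proposition 2] [cite: Tate1967, §3.3] -/
theorem exists_plog_eq_gal_sub_of_semiInvariant (M : IntermediateField F (NormedAlgClosure F))
    [FiniteDimensional F M] {x : PadicCompletedAlgClosure F p hp} (hx : x ≠ 0)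
    {φ : absoluteGaloisGroup F → PadicCompletedAlgClosure F p hp}
    (hφ : ∀ σ : absoluteGaloisGroup F, (∀ y ∈ M, σ • y = y) → gal hp σ x = φ σ * x)
    {ε : ℝ} (hε : 0 < ε) (hε1 : ε ≤ 1) :
    ∃ M' : IntermediateField F (NormedAlgClosure F), M ≤ M' ∧ FiniteDimensional F M' ∧
      ∃ c : PadicCompletedAlgClosure F p hp, ∀ σ : absoluteGaloisGroup F, (∀ y ∈ M', σ • y = y) →
        ‖1 - φ σ‖ < ε ∧ PadicExp.plog (φ σ) = gal hp σ c - c := by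
  obtain ⟨a, ha0, hav⟩ := exists_coe_ne_zero_norm_div_sub_one_lt hp hx hε
  set v : PadicCompletedAlgClosure F p hp := x / ofAlgClosure hp a with hv
  have hv1 : ‖v - 1‖ < 1 := lt_of_lt_of_le hav hε1
  have hnv : ‖v‖ = 1 := norm_eq_one_of_norm_sub_one_lt hp hv1
  have hv0 : v ≠ 0 := norm_pos_iff.mp (by rw [hnv]; exact one_pos)
  -- `M' = M ⊔ F(a)`
  have haint : IsIntegral F a := (Algebra.IsAlgebraic.isAlgebraic (R := F) a).isIntegral
  haveI : FiniteDimensional F F⟮a⟯ := IntermediateField.adjoin.finiteDimensional haint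
  refine ⟨M ⊔ F⟮a⟯, le_sup_left, IntermediateField.finiteDimensional_sup M F⟮a⟯, PadicExp.plog v,
    fun σ hσ => ?_⟩
  have hσM : ∀ y ∈ M, σ • y = y := fun y hy => hσ y ((le_sup_left : M ≤ M ⊔ F⟮a⟯) hy)
  have hσa : σ • a = a :=
    hσ a ((le_sup_right : F⟮a⟯ ≤ M ⊔ F⟮a⟯) (IntermediateField.mem_adjoin_simple_self F a))
  -- `σ v = φ(σ) v`
  have hgv : gal hp σ v = φ σ * v := by
    rw [hv, map_div₀, gal_ofAlgClosure, hσa, hφ σ hσM, mul_div_assoc]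
  have hφσ : φ σ = gal hp σ v / v := by rw [hgv, mul_div_cancel_right₀ _ hv0]
  -- `‖1 − φ σ‖ < ε`
  have hg1 : ‖1 - gal hp σ v‖ = ‖v - 1‖ := by
    rw [show (1 : PadicCompletedAlgClosure F p hp) - gal hp σ v = gal hp σ (1 - v) by
      rw [map_sub, map_one], norm_gal, ← norm_neg, neg_sub]
  have hsmall : ‖1 - φ σ‖ < ε := by
    have h1 : 1 - φ σ = ((1 - gal hp σ v) - (1 - v)) / v := by
      rw [hφσ]; field_simp; ring
    rw [h1, norm_div, hnv, div_one, sub_eq_add_neg]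
    refine lt_of_le_of_lt (norm_add_le_max _ _) (max_lt ?_ ?_)
    · rw [hg1]; exact hav
    · rw [norm_neg, ← norm_neg, neg_sub]; exact hav
  refine ⟨hsmall, ?_⟩
  -- `plog φ(σ) = plog (σ v) − plog v = σ (plog v) − plog v`
  have hinv1 : ‖1 - v⁻¹‖ < 1 := by
    have h1 : 1 - v⁻¹ = (v - 1) / v := by field_simp
    rwa [h1, norm_div, hnv, div_one]
  have h1v : ‖1 - v‖ < 1 := by rw [← norm_neg, neg_sub]; exact hv1
  rw [hφσ, div_eq_mul_inv, PadicExp.plog_mul (ℓ := p) (by rw [hg1]; exact hv1) hinv1,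
    PadicExp.plog_inv (ℓ := p) h1v, gal_plog hp σ h1v, sub_eq_add_neg]

/-! ## §3 Open subgroups of `Γ_F` contain fixators of finite extensions -/

omit [ValuativeRel F] [TopologicalSpace F] [IsNonarchimedeanLocalField F] [CharZero F] hprime in
/-- **Every neighbourhood of `1` in `Γ_F` contains the pointwise fixator of a finite extension `M' ⊇ M`**
(Krull topology: Mathlib `krullTopology_mem_nhds_one_iff` on `Gal(F̄/F)`, transported to the tree's synonym
`NormedAlgClosure F` of `F̄` and joined with `M`). [cite: NeukirchANT1999, Ch. IV §1] -/
theorem _root_.Literature.NumberTheory.PAdicHodge.exists_intermediateField_finiteDimensional_fixing_subset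
    {F : Type} [Field F] [ValuativeRel F] [TopologicalSpace F] [IsNonarchimedeanLocalField F]
    (M : IntermediateField F (NormedAlgClosure F)) [FiniteDimensional F M]
    {s : Set (absoluteGaloisGroup F)} (hs : s ∈ 𝓝 (1 : absoluteGaloisGroup F)) :
    ∃ M' : IntermediateField F (NormedAlgClosure F), M ≤ M' ∧ FiniteDimensional F M' ∧
      ∀ σ : absoluteGaloisGroup F, (∀ y ∈ M', σ • y = y) → σ ∈ s := by
  have hs' : s ∈ 𝓝 (1 : AlgebraicClosure F ≃ₐ[F] AlgebraicClosure F) := hs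
  obtain ⟨E, hEfd, hEs⟩ := (krullTopology_mem_nhds_one_iff F (AlgebraicClosure F) s).mp hs'
  -- transport `E` to the synonym `NormedAlgClosure F`
  set f : AlgebraicClosure F →ₐ[F] NormedAlgClosure F :=
    (NormedAlgClosure.toAlgClosure (F := F)).symm.toAlgHom with hf
  set E' : IntermediateField F (NormedAlgClosure F) := E.map f with hE'
  haveI : FiniteDimensional F E' := LinearEquiv.finiteDimensional (IntermediateField.equivMap E f).toLinearEquiv
  refine ⟨M ⊔ E', le_sup_left, IntermediateField.finiteDimensional_sup M E', fun σ hσ => hEs ?_⟩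
  rw [SetLike.mem_coe, IntermediateField.mem_fixingSubgroup_iff]
  intro x hx
  have hmem : f x ∈ M ⊔ E' := (le_sup_right : E' ≤ M ⊔ E') ((IntermediateField.mem_map (S := E)).mpr ⟨x, hx, rfl⟩)
  have h := hσ (f x) hmem
  -- `σ • f x = f (σ x)` (everything is the identity map)
  exact h

end PadicCompletedAlgClosure

end Literature.NumberTheory.PAdicHodge
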